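import Mathlib
import HarnessLib

/-!
# Non-square descent — INVERSE-LIMIT BOOKKEEPING FOR THE S3 (c) CERTIFICATE: `rank_{Λ'} = 1` IN MATHLIB'S CURRENCY AND THE JOINT
# INJECTIVITY `hsep` OF THE PROJECTIONS `V_∞ → V_n` (König / Mittag-Leffler for finite `2`-torsion) — seed crux `SignedMuSeedAtTwoPlus`
# stmt-BirchSwinnertonDyer-21438 (parent Kμ⁺ `SignedMuVanishingAtTwoPlus` stmt-BirchSwinnertonDyer-20689, route ResidualThetaTransportAtTwo),
# line card `Cruxes/SignedMuSeedAtTwoPlus/Lines/nonsquare-descent.md`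

Cell `bsd-wall`, width seat `bsd-wall-rtt-p4-w2` g18 (`--supports`, closes nothing).  THEOREMS ONLY; BSD is not proved by this and
nothing arithmetic is asserted: module algebra and a finite-inverse-system argument.

Two more INPUTS of g17's certificate `isTorsion_quotient_iff_exists_proj_ne_zero` (`Theorems/…NonsquareDescentCertificate.lean`), left in
the hypothesis ledger of `Cruxes/SignedMuVanishingAtTwoPlus/NonsquareDescentKernel.md` §2 as «inverse-limit bookkeeping»:

* §1 `rank_le_one_of_moduleRank_le_one` — the working hypothesis «any two elements are linearly dependent» (input `hrank` over `Λ'` of this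
  lane's `rank_le_one_modP`, `exists_injective_linearMap_of_rank_le_one`) from Mathlib's `Module.rank Λ' Ē^χ ≤ 1` — the card's
  «`rank_{Λ'} Ē^χ = 1`» read literally.
* §2 **`exists_coherent_smul_eq`** — KÖNIG FOR DIVISION BY `c`: along a tower `N n : E (n+1) → E n` whose `c`-torsion is finite at every
  level, a norm-coherent sequence `x` that is divisible by `c` LEVELWISE is `c •` a norm-coherent sequence (the solution sets
  `{y : c • y = x n}` form an inverse system of finite non-empty sets; Mathlib `nonempty_sections_of_finite_inverse_system`).
* §3 **`mem_smul_of_forall_proj_mem_smul`**, **`proj_jointly_injective`** — hence for `E_∞ =` the module of coherent sequences (given by an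
  embedding `emb : E_∞ ↪ Π E n` onto the coherent sequences): `z ∈ c E_∞ ⟺ zₙ ∈ c Eₙ ∀ n`, i.e. the projections
  `E_∞/cE_∞ → Eₙ/cEₙ` JOINTLY DETECT `0` — LITERALLY the input `hsep` of the certificate (`V_∞ = Ē^χ/2 → V_n = 𝓔_n^χ/2`, `c = 2`,
  finiteness of `𝓔_n^χ[2] ⊆ μ₂`).

[folklore]
-/

set_option autoImplicit false
-- the Theorems namespace of this sub repeats the summit name by design (D-0017 nested layout)
set_option linter.dupNamespace false

open scoped Pointwise

universe u v

namespace Summit.BirchSwinnertonDyer.BirchSwinnertonDyer.Theorems.SignedMuAtTwo.NonsquareDescent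

/-! ## §1 `Module.rank ≤ 1` ⇒ any two elements are dependent -/

section RankCurrency

variable {R : Type u} [CommRing R] [Nontrivial R] {E : Type v} [AddCommGroup E] [Module R E]

/-- **`rank_R E ≤ 1` (Mathlib's `Module.rank`) ⇒ any two elements of `E` are linearly dependent** — the working form `hrank` used
throughout this lane (an independent pair would give `2 ≤ rank`). [folklore] -/
theorem rank_le_one_of_moduleRank_le_one (h : Module.rank R E ≤ 1) (v w : E) :
    ∃ a b : R, (a ≠ 0 ∨ b ≠ 0) ∧ a • v + b • w = 0 := by
  by_contra hne
  push Not at hne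
  have hli : LinearIndependent R ![v, w] := by
    rw [LinearIndependent.pair_iff]
    intro s t hst
    by_contra h'
    exact hne s t (by tauto) hst
  have h2 := hli.cardinal_lift_le_rank
  rw [Cardinal.mk_fin, Cardinal.lift_natCast] at h2
  have h3 : ((2 : ℕ) : Cardinal) ≤ ((1 : ℕ) : Cardinal) := by
    rw [Nat.cast_one]
    exact h2.trans (by simpa using h)
  have h4 : (2 : ℕ) ≤ 1 := by exact_mod_cast h3
  omega

/-- The card's literal «`rank_{Λ'} Ē^χ = 1`»: `Module.rank R E = 1` ⇒ `hrank`. [folklore] -/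
theorem rank_le_one_of_moduleRank_eq_one (h : Module.rank R E = 1) (v w : E) :
    ∃ a b : R, (a ≠ 0 ∨ b ≠ 0) ∧ a • v + b • w = 0 :=
  rank_le_one_of_moduleRank_le_one h.le v w

end RankCurrency

/-! ## §2 König for division by `c` along a tower with finite `c`-torsion -/

section Koenig

open CategoryTheory

variable {R : Type u} [CommRing R] (E : ℕ → Type v) [∀ n, AddCommGroup (E n)] [∀ n, Module R (E n)]
  (N : ∀ n, E (n + 1) →ₗ[R] E n)

/-- The solution set `{y ∈ Eₙ : c • y = xₙ}` of a solvable equation is finite when the `c`-torsion `Eₙ[c]` is finite (it is a torsor).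
[folklore] -/
theorem finite_solutions_of_finite_torsionBy {M : Type*} [AddCommGroup M] [Module R M] (c : R)
    (hfin : Finite {y : M // c • y = 0}) (x : M) : Finite {y : M // c • y = x} := by
  by_cases hsol : ∃ y₀ : M, c • y₀ = x
  · obtain ⟨y₀, hy₀⟩ := hsol
    refine Finite.of_injective
      (fun y : {y : M // c • y = x} => (⟨y.1 - y₀, by rw [smul_sub, y.2, hy₀, sub_self]⟩ : {y : M // c • y = 0}))
      fun y y' h => ?_
    have h1 := congrArg Subtype.val h
    exact Subtype.ext (sub_left_injective h1)
  · haveI : IsEmpty {y : M // c • y = x} := ⟨fun y => hsol ⟨y.1, y.2⟩⟩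
    infer_instance

/-- **König for division by `c`.**  Along a tower `N n : E (n+1) → E n` with finite `c`-torsion at every level, a norm-coherent sequence
`x` (`N (x (n+1)) = x n`) that is divisible by `c` at every level is `c •` a norm-coherent sequence: the solution sets form an inverse
system of finite non-empty sets, which has a section (Mathlib `nonempty_sections_of_finite_inverse_system`). («a coherent family of
doubles in `lim 𝓔_n` is the double of a coherent family», `𝓔_n[2]` finite.) [folklore] -/
theorem exists_coherent_smul_eq (c : R) (hfin : ∀ n, Finite {y : E n // c • y = 0})
    (x : ∀ n, E n) (hx : ∀ n, N n (x (n + 1)) = x n) (hsol : ∀ n, ∃ y : E n, c • y = x n) :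
    ∃ y : ∀ n, E n, (∀ n, N n (y (n + 1)) = y n) ∧ ∀ n, c • y n = x n := by
  classical
  let X : ℕ → Type v := fun n => {y : E n // c • y = x n}
  let f : ∀ n, (X (n + 1) ⟶ X n) := fun n =>
    TypeCat.ofHom fun y => ⟨N n y.1, by rw [← map_smul, y.2, hx]⟩
  haveI hne : ∀ n, Nonempty (X n) := fun n => by
    obtain ⟨y, hy⟩ := hsol n
    exact ⟨⟨y, hy⟩⟩
  haveI hfi : ∀ n, Finite (X n) := fun n => finite_solutions_of_finite_torsionBy c (hfin n) (x n)
  haveI : ∀ j : ℕᵒᵖ, Nonempty ((Functor.ofOpSequence f).obj j) := fun j => hne j.unop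
  haveI : ∀ j : ℕᵒᵖ, Finite ((Functor.ofOpSequence f).obj j) := fun j => hfi j.unop
  obtain ⟨s, hs⟩ := nonempty_sections_of_finite_inverse_system (Functor.ofOpSequence f)
  refine ⟨fun n => (s (Opposite.op n)).1, fun n => ?_, fun n => (s (Opposite.op n)).2⟩
  have h1 := hs (homOfLE (Nat.le_add_right n 1)).op
  rw [Functor.ofOpSequence_map_homOfLE_succ] at h1
  have h2 := congrArg Subtype.val h1
  exact h2

end Koenig

/-! ## §3 `hsep`: the projections `E_∞/cE_∞ → Eₙ/cEₙ` jointly detect `0` -/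

section Separation

variable {R : Type u} [CommRing R] (E : ℕ → Type v) [∀ n, AddCommGroup (E n)] [∀ n, Module R (E n)]
  (N : ∀ n, E (n + 1) →ₗ[R] E n)
  {Einf : Type*} [AddCommGroup Einf] [Module R Einf]

/-- **`z ∈ c E_∞ ⟺ zₙ ∈ c Eₙ` for all `n`.**  `E_∞` is given by an injective `R`-linear `emb : E_∞ → Π Eₙ` whose image is exactly the
norm-coherent sequences; `c`-torsion finite at every level.  If every component of `emb z` is divisible by `c`, then `z = c • z'`.
[folklore] -/
theorem mem_smul_of_forall_proj_mem_smul (emb : Einf →ₗ[R] (∀ n, E n)) (hemb : Function.Injective emb)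
    (hcoh : ∀ (z : Einf) (n : ℕ), N n (emb z (n + 1)) = emb z n)
    (hsurj : ∀ x : ∀ n, E n, (∀ n, N n (x (n + 1)) = x n) → ∃ z : Einf, emb z = x)
    (c : R) (hfin : ∀ n, Finite {y : E n // c • y = 0})
    (z : Einf) (hz : ∀ n, ∃ y : E n, c • y = emb z n) : ∃ z' : Einf, z = c • z' := by
  obtain ⟨y, hy, hcy⟩ := exists_coherent_smul_eq E N c hfin (emb z) (hcoh z) hz
  obtain ⟨z', hz'⟩ := hsurj y hy
  refine ⟨z', hemb ?_⟩
  rw [map_smul, hz']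
  exact funext fun n => by rw [Pi.smul_apply, hcy]

variable {W : ℕ → Type*} [∀ n, AddCommGroup (W n)] [∀ n, Module R (W n)]
  {Winf : Type*} [AddCommGroup Winf] [Module R Winf]

/-- **`hsep`: the projections `V_∞ → V_n` jointly detect `0`.**  With `E_∞ ↪ Π Eₙ` onto the coherent sequences (finite `c`-torsion at each
level), `qinf : E_∞ ↠ V_∞` `R`-linear with `qinf (c • z) = 0`, `q n : Eₙ → Vₙ` `R`-linear with `q n e = 0 → e ∈ c Eₙ`, and projections
`π n : V_∞ → Vₙ` with `π n (qinf z) = q n (emb z n)`: if `π n v = 0` for all `n` then `v = 0`.  (For the card: `E_∞ = Ē^χ`, `c = 2`,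
`V_∞ = Ē^χ/2`, `Vₙ = 𝓔ₙ^χ/2`, `𝓔ₙ^χ[2] ⊆ μ₂` finite — the input `hsep` of `isTorsion_quotient_iff_exists_proj_ne_zero`, stated for
`R`-linear `π n`; any `k⟦X⟧`-linear projections restrict to such.) [folklore] -/
theorem proj_jointly_injective (emb : Einf →ₗ[R] (∀ n, E n)) (hemb : Function.Injective emb)
    (hcoh : ∀ (z : Einf) (n : ℕ), N n (emb z (n + 1)) = emb z n)
    (hsurj : ∀ x : ∀ n, E n, (∀ n, N n (x (n + 1)) = x n) → ∃ z : Einf, emb z = x)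
    (c : R) (hfin : ∀ n, Finite {y : E n // c • y = 0})
    (qinf : Einf →ₗ[R] Winf) (hqinf : Function.Surjective qinf) (hqc : ∀ z : Einf, qinf (c • z) = 0)
    (q : ∀ n, E n →ₗ[R] W n) (hq : ∀ n (e : E n), q n e = 0 → ∃ y : E n, c • y = e)
    (π : ∀ n, Winf → W n) (hπ : ∀ (z : Einf) (n : ℕ), π n (qinf z) = q n (emb z n))
    (v : Winf) (hv : ∀ n, π n v = 0) : v = 0 := by
  obtain ⟨z, rfl⟩ := hqinf v
  have hz : ∀ n, ∃ y : E n, c • y = emb z n := fun n => hq n _ (by rw [← hπ, hv])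
  obtain ⟨z', rfl⟩ := mem_smul_of_forall_proj_mem_smul E N emb hemb hcoh hsurj c hfin z hz
  exact hqc z'

/-- The kernel hypothesis `hq` for the actual quotient maps `Eₙ → Eₙ ⧸ cEₙ`. [folklore] -/
theorem exists_smul_eq_of_mkQ_eq_zero {M : Type*} [AddCommGroup M] [Module R M] (c : R) (e : M)
    (h : (c • (⊤ : Submodule R M)).mkQ e = 0) : ∃ y : M, c • y = e := by
  rw [Submodule.mkQ_apply, Submodule.Quotient.mk_eq_zero, Submodule.mem_smul_pointwise_iff_exists] at h
  obtain ⟨y, -, hy⟩ := h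
  exact ⟨y, hy⟩

/-- The hypothesis `hqc` for the actual quotient map `E_∞ → E_∞ ⧸ cE_∞`. [folklore] -/
theorem mkQ_smul_eq_zero (c : R) (z : Einf) : (c • (⊤ : Submodule R Einf)).mkQ (c • z) = 0 := by
  rw [Submodule.mkQ_apply, Submodule.Quotient.mk_eq_zero]
  exact Submodule.smul_mem_pointwise_smul z c ⊤ Submodule.mem_top

end Separation

end Summit.BirchSwinnertonDyer.BirchSwinnertonDyer.Theorems.SignedMuAtTwo.NonsquareDescent
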